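import Literature.Computability.AlgebraicComplexity.IP17KroneckerPositivity
import Literature.Computability.AlgebraicComplexity.SkewCircuitLinComb
import Literature.Computability.AlgebraicComplexity.SkewCircuitLinSubst
import Literature.Computability.AlgebraicComplexity.SkewCircuitAffineSubstitution
import Literature.Computability.AlgebraicComplexity.BLMW11WeaklySkewToSkewProofs
import Literature.Computability.AlgebraicComplexity.ConstantFreeCircuits
import Literature.Computability.AlgebraicComplexity.ArithCircuitProofs
import Literature.Computability.AlgebraicComplexity.OrbitClosureProofs
import Literature.Computability.AlgebraicComplexity.DeterminantalComplexityProofs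
import HarnessLib

/-!
# Ikenmeyer–Panova 2017, Appendix §7, Claim 7.1 (padding with `X_{1,1}` versus a fresh variable)
# — PROVED (discharge of `ikenmeyerPanova2017_claim_7_1`)

Topic `Literature/Computability/AlgebraicComplexity`; a PROOFS file (D-0014): theorems only, no facts,
no definitions.

C. Ikenmeyer, G. Panova, *Rectangular Kronecker coefficients and plethysms in geometric complexity
theory*, Adv. Math. 319 (2017) 40–66 = arXiv:1512.03798, Appendix §7 (TeX L1498–1522; held:
`paper:arxiv-1512.03798` chunk p0017, Claim 35). "In the literature sometimes `(X_{n,n})^{n-m} per_m`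
is called the padded permanent instead of `(X_{1,1})^{n-m} per_m` … **Claim.** There exists a function
`N = N(n)` that is polynomially bounded in `n` such that if `X_{1,1}^{n-m} per_m ∈ E_n det_n`, then
`X_{N,N}^{N-m} per_m ∈ E_N det_N`." Typed in `IP17KroneckerPositivity.lean` as the named fact
`ikenmeyerPanova2017_claim_7_1` (tree letters: permanent size `n`, matrix size `m`;
`bipPaddedPerPoly ℂ n m` = BIP's `X₀₀^{m-n} per_n` with `X₀₀` a variable OF the permanent's block;
`paddedPerPoly ℂ n N` = the padding by a variable outside the block; `E_m det_m` =
`endOrbit _ ℂ (detPoly (Fin m) ℂ)`; "polynomially bounded" = `IsPBounded`). DISCHARGED here: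
**`ikenmeyerPanova2017_claim_7_1_holds`**, with the explicit polynomial
`N(m) = 3 · (4 (B₁(m) + m²)(2m² + 3) + 10) + 1 + m`,
`B₁(m) = m²(m²+1) + (2m²+2) · 4 · (m+2)(4m³+7)²`.

## The printed proof and how it is followed (TeX L1509–1517)

"Let `det_n` have skew circuits of size `q(n)` with `q(n)` polynomially bounded in `n`. Let
`X_{1,1}^{n-m} per_m ∈ E_n det_n`. Then there exists a size `q(n)` skew circuit computing
`X_{1,1}^{n-m} per_m`. The polynomial `per_m` is multilinear and we collect terms that involve
`X_{1,1}` using the notation `per_m = X_{1,1} P + Q`, where `X_{1,1}` does not appear in `P` or `Q`.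
Setting `X_{1,1} ← 1` … we obtain `R₁ := P + Q` and setting `X_{1,1} ← 2` we obtain
`R₂ := 2^{n-m+1} P + 2^{n-m} Q`. We see that `P = -2^{-(n-m)}(2^{n-m} R₁ - R₂)` and
`Q = 2^{-(n-m)}(2^{n-m+1} R₁ - R₂)`, which gives size `2q(n)+3` skew circuits for `P` and `Q`. Thus
we get a size `N := 2(2q(n)+3)+2 = 4q(n)+8` skew circuit for `per_m = X_{1,1} P + Q`. Homogenizing
with `X_{N,N}` as the padding variable we see `X_{N,N}^{N-m} per_m ∈ E_N det_N`."

Step by step, in the currency of the tree's (corrected, well-formed) skew complexity `L_skew`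
(`skewComplexity`, `BLMW11KroneckerApproximation.lean`):

1. skew circuits for `det_m` and for everything in `E_m det_m`: `L_ws(det_m) ≤ (m+2)(4m³+7)²`
   (`HI16Skew.wsComplexity_detPoly_le`, t14), `L_skew ≤ 4 L_ws` (`skewComplexity_le_four_mul_wsComplexity`,
   t15), closure under linear substitution `skewComplexity_le_of_mem_endOrbit` (`SkewCircuitLinSubst.lean`)
   — `skewComplexity_le_of_mem_endOrbit_detPoly`;
2. "`per_m` is multilinear … `per_m = X_{1,1} P + Q`": `exists_perPoly_eq_X_mul_add` (split the sum
   over permutations by `π(a) = a`);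
3. the substitutions `X_{1,1} ← 1, 2` are affine substitutions: `skewComplexity_aeval_pointSubst_le`
   (from `skewComplexity_aeval_affine_le`, `SkewCircuitAffineSubstitution.lean`, t14);
4. `P`, `Q` as the printed linear combinations of `R₁, R₂`: `skewComplexity_sum_smul_le`
   (`SkewCircuitLinComb.lean`); `X_{1,1} · P` is ONE more skew product gate
   (`skewComplexity_mul_X_le`, via the tree's `ArithCircuit.mul _ (ofVar _)`); the sum `+ Q`
   (`skewComplexity_add_le`) — `skewComplexity_le_of_eq_X_pow_mul`:
   `L_skew(per) ≤ 4 (L_skew(X₀₀^e per) + m²)(2m²+3) + 10` (the tree's size constants differ from the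
   printed `4q(n)+8`, which counts a different circuit model; only polynomiality matters);
5. a skew circuit of size `s` computes a projection of `det_{3s+1}` (`HI16Skew.isProjection_detPoly_of_isSkew`,
   Malod–Portier 2008 Lemma 6 à la Toda / Hüttenhain–Ikenmeyer), hence an affine determinantal
   representation (`IsDetProjection.hasDetRepr_holds`) — `hasDetRepr_of_skewComplexity`; transported
   from the renamed block permanent back to `per_n` (`hasDetRepr_of_rename`); padded up to `N(m)`
   (`HasDetRepr.mono_holds`) — `hasDetRepr_perPoly_of_bipPadded_mem_endOrbit`;
6. "Homogenizing with `X_{N,N}` as the padding variable": the tree's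
   `X_pow_mul_rename_mem_endOrbit_detPoly` (`OrbitClosureProofs.lean`, the lemma behind
   `paddedPerPoly_mem_orbitClosure_detPoly_of_hasDetRepr_holds`), giving
   `paddedPerPoly ℂ n (N m) ∈ E_{N(m)} det_{N(m)}`; `IsPBounded N` through
   `isPBounded_iff_exists_polynomial_holds` (an explicit `ℕ[X]` polynomial), and `m ≤ N(m)`.

The converse direction of the appendix ("Clearly if `X_{n,n}^{n-m} per_m ∈ E_n det_n`, then also
`X_{1,1}^{n-m} per_m ∈ E_n det_n` by setting `X_{n,n} ← X_{1,1}`") is not part of the typed fact and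
not formalised here.

HONEST FRAMING (cell val-lit, seat t05 g4): a bookkeeping equivalence of two padding conventions for
the permanent-versus-determinant problem (polynomial blow-up `N(m)`); nothing here is progress on
VP versus VNP, which is NOT proved.

## References

* [IkenmeyerPanova2017] C. Ikenmeyer, G. Panova, Adv. Math. 319 (2017) = arXiv:1512.03798, §7
  Claim 7.1 (TeX L1498–1522; held chunk p0017, Claim 35).
* [BurgisserEtAl2011] P. Bürgisser, J. M. Landsberg, L. Manivel, J. Weyman, SIAM J. Comput. 40 (2011),
  §9.1 (i) (`det ∈ VP_ws`), §9.3 (closure under the linear action), §9.4 (skew circuits).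
* [MalodPortier2008] G. Malod, N. Portier, J. Complexity 24 (2008), Lemma 6 (universality of the
  determinant for (weakly) skew circuits).
* [HuttenhainIkenmeyer2016] J. Hüttenhain, C. Ikenmeyer, *Binary determinantal complexity*,
  Linear Algebra Appl. 504 (2016), §5 (skew circuits).
* [Burgisser2000] P. Bürgisser, *Completeness and Reduction in Algebraic Complexity Theory*,
  Def. 2.1, §2.5 (circuits; projections and determinantal representations).
* [MulmuleySohoniSIAM2001] K. Mulmuley, M. Sohoni, SIAM J. Comput. 31 (2001), Prop. 4.4 (padding and
  `End · det`).

## Mathlib and tree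

Mathlib: `Matrix.permanent`, `Finset.sum_filter_add_sum_filter_not`, `Finset.mul_prod_erase`,
`MvPolynomial.aeval_rename`, `MvPolynomial.aeval_X_left`, `Fintype.card_fin_lt_of_le`,
`Polynomial.eval_*`.
Tree: `ikenmeyerPanova2017_claim_7_1`, `bipPaddedPerPoly`, `TopBlockIdx` (statement side);
`paddedPerPoly`, `BlockIdx`, `card_blockIdx`, `endOrbit`, `X_pow_mul_rename_mem_endOrbit_detPoly`,
`rename_perPoly_equiv`, `perPoly_isHomogeneous` (`OrbitClosure(Proofs)`, `StandardFamilies`);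
`skewComplexity`, `skewComplexity_le_size`, `HI16Skew.skewComplexity_attained`,
`HI16Skew.wsComplexity_detPoly_le`, `HI16Skew.isProjection_detPoly_of_isSkew`
(`BLMW11KroneckerApproximation`, `BLMW11WeaklySkewDetProofs`); `skewComplexity_le_four_mul_wsComplexity`
(`BLMW11WeaklySkewToSkewProofs`); `skewComplexity_le_of_mem_endOrbit` (`SkewCircuitLinSubst`);
`skewComplexity_aeval_affine_le`, `ArithCircuit.SkewSubst.psi` (`SkewCircuitAffineSubstitution`);
`skewComplexity_sum_smul_le`, `skewComplexity_add_le` (`SkewCircuitLinComb`); `ArithCircuit.mul`,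
`ofVar`, `mul_eval`, `size_mul`, `IsFanInTwo.mul/ofVar` (`ArithCircuit(Proofs)`, `ConstantFreeCircuits`);
`HasDetRepr`, `HasDetRepr.mono_holds`, `HasDetRepr.of_isProjection_holds`,
`IsDetProjection.hasDetRepr_holds` (`DeterminantalComplexity(Proofs)`); `IsPBounded`,
`isPBounded_iff_exists_polynomial_holds` (`ValiantClasses`).
-/

noncomputable section

open scoped BigOperators
open MvPolynomial

namespace Literature.Computability.AlgebraicComplexity

namespace IP17Padding

open ArithCircuit

variable {k : Type*} [CommRing k] {σ : Type*}

/-! ### §1. One skew product gate: `L_skew(f · X_i) ≤ L_skew(f) + 1` -/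

/-- `P * X_i` (the tree's `ArithCircuit.mul` with the gate-free circuit `ofVar i`) is well formed
if `P` is: its one new product gate reads the (truncated) output of `P` and the input `X_i`.
[cite: Burgisser2000, Def. 2.1] -/
theorem wellFormed_mul_ofVar {P : ArithCircuit k σ} (hP : P.WellFormed) (i : σ) :
    (P.mul (ArithCircuit.ofVar i)).WellFormed := by
  refine ⟨fun l g hg u hu => ?_, ?_⟩
  · simp only [ArithCircuit.mul, ArithCircuit.append, ArithCircuit.ofVar, List.map_nil,
      List.append_nil] at hg
    rcases Nat.lt_or_ge l P.gates.length with hl | hl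
    · rw [List.getElem?_append_left hl] at hg
      exact hP.1 l g hg u hu
    · rw [List.getElem?_append_right hl] at hg
      have hl' : l - P.gates.length = 0 := by
        rcases Nat.eq_zero_or_pos (l - P.gates.length) with h | h
        · exact h
        · rw [List.getElem?_eq_none_iff.mpr (by simp; omega)] at hg
          exact absurd hg (by simp)
      rw [hl'] at hg
      simp only [List.getElem?_cons_zero, Option.some.injEq] at hg
      subst hg
      have hl0 : l = P.size := by unfold ArithCircuit.size; omega
      simp only [Gate.args, List.mem_cons, List.not_mem_nil, or_false] at hu
      rcases hu with rfl | rfl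
      · cases ho : P.output with
        | var x => simp [Operand.truncate, Operand.RefsBelow]
        | const c => simp [Operand.truncate, Operand.RefsBelow]
        | gate j =>
          simp only [Operand.truncate]
          split_ifs with hj
          · rw [hl0]; exact hj
          · trivial
      · simp [Operand.shift, Operand.RefsBelow]
  · show (P.size + 0) < (P.mul (ArithCircuit.ofVar i)).size
    rw [size_mul, size_ofVar]
    omega

/-- `P * X_i` is skew if `P` is (the new product gate has the input `X_i` as an operand).
[cite: HuttenhainIkenmeyer2016, §5] -/
theorem isSkew_mul_ofVar {P : ArithCircuit k σ} (hP : P.IsSkew) (i : σ) :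
    (P.mul (ArithCircuit.ofVar i)).IsSkew := by
  intro g hg
  simp only [ArithCircuit.mul, ArithCircuit.append, ArithCircuit.ofVar, List.map_nil,
    List.append_nil, List.mem_append, List.mem_singleton] at hg
  rcases hg with hg | rfl
  · exact hP g hg
  · show [P.output.truncate P.size, Operand.var i].countP Operand.isGateRef ≤ 1
    have hv : (Operand.var i : Operand k σ).isGateRef = false := rfl
    rw [List.countP_cons, List.countP_cons, List.countP_nil, hv]
    cases (P.output.truncate P.size).isGateRef <;> simp

/-- **Skew complexity under multiplication by an input variable**: `L_skew(f · X_i) ≤ L_skew(f) + 1`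
(one skew product gate appended to a size-optimal well-formed skew circuit).
[cite: BurgisserEtAl2011, §9.4 (skew circuits)] -/
theorem skewComplexity_mul_X_le (f : MvPolynomial σ k) (i : σ) :
    skewComplexity (f * X i) ≤ skewComplexity f + 1 := by
  obtain ⟨P, hwf, h2, hsk, hc, hsz⟩ := HI16Skew.skewComplexity_attained f
  have h := skewComplexity_le_size (f := f * X i) (P.mul (ArithCircuit.ofVar i))
    (wellFormed_mul_ofVar hwf i) (h2.mul (IsFanInTwo.ofVar i)) (isSkew_mul_ofVar hsk i)
    (by rw [ArithCircuit.Computes, mul_eval, ArithCircuit.eval_ofVar]; rw [ArithCircuit.Computes] at hc; rw [hc])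
  rw [size_mul, size_ofVar, hsz] at h
  simpa using h

/-! ### §2. The permanent is linear in each variable: `per = X_{aa} · P + Q` -/

/-- **The permanent is multilinear** (in the form used by the printed proof: "The polynomial
`per_m` is multilinear and we collect terms that involve `X_{1,1}` using the notation
`per_m = X_{1,1} P + Q`, where `X_{1,1}` does not appear in `P` or `Q`"), for the permanent of the
generic matrix placed on the variables `(j r, j c)` of a bigger variable set by an injective `j`:
`per = X_{(ja, ja)} · P + Q` with `P, Q` fixed by every substitution that moves only `X_{(ja,ja)}`.
[cite: IkenmeyerPanova2017, §7 Claim 7.1 (proof; TeX L1511–1512)] -/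
theorem exists_perPoly_eq_X_mul_add {n τ : Type*} [Fintype n] [DecidableEq n] [DecidableEq τ]
    (j : n → τ) (hj : Function.Injective j) (a : n) :
    ∃ P Q : MvPolynomial (τ × τ) k,
      rename (Prod.map j j) (perPoly n k) = X (j a, j a) * P + Q ∧
      ∀ Φ : τ × τ → MvPolynomial (τ × τ) k, (∀ v, v ≠ (j a, j a) → Φ v = X v) →
        aeval Φ P = P ∧ aeval Φ Q = Q := by
  classical
  -- the two halves of the sum over permutations
  refine ⟨∑ π ∈ (Finset.univ : Finset (Equiv.Perm n)).filter (fun π => π a = a),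
      ∏ i ∈ Finset.univ.erase a, X (j (π i), j i),
    ∑ π ∈ (Finset.univ : Finset (Equiv.Perm n)).filter (fun π => ¬ π a = a),
      ∏ i, X (j (π i), j i), ?_, ?_⟩
  · have hper : rename (Prod.map j j) (perPoly n k) =
        ∑ π : Equiv.Perm n, ∏ i, (X (j (π i), j i) : MvPolynomial (τ × τ) k) := by
      simp only [perPoly, Matrix.permanent, map_sum, map_prod, Matrix.mvPolynomialX_apply, rename_X,
        Prod.map_apply]
    rw [hper, ← Finset.sum_filter_add_sum_filter_not Finset.univ (fun π : Equiv.Perm n => π a = a),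
      Finset.mul_sum]
    congr 1
    refine Finset.sum_congr rfl fun π hπ => ?_
    rw [Finset.mem_filter] at hπ
    rw [← Finset.mul_prod_erase Finset.univ (fun i => (X (j (π i), j i) : MvPolynomial (τ × τ) k))
      (Finset.mem_univ a), hπ.2]
  · intro Φ hΦ
    have hX : ∀ π : Equiv.Perm n, ∀ i, (i ≠ a ∨ π a ≠ a) →
        aeval Φ (X (j (π i), j i) : MvPolynomial (τ × τ) k) = X (j (π i), j i) := by
      intro π i h
      rw [aeval_X]
      apply hΦ
      intro heq
      rw [Prod.mk.injEq] at heq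
      have hi : i = a := hj heq.2
      rcases h with h | h
      · exact h hi
      · subst hi; exact h (hj heq.1)
    refine ⟨?_, ?_⟩
    · rw [map_sum]
      refine Finset.sum_congr rfl fun π _ => ?_
      rw [map_prod]
      refine Finset.prod_congr rfl fun i hi => hX π i (Or.inl (Finset.ne_of_mem_erase hi))
    · rw [map_sum]
      refine Finset.sum_congr rfl fun π hπ => ?_
      rw [Finset.mem_filter] at hπ
      rw [map_prod]
      exact Finset.prod_congr rfl fun i _ => hX π i (Or.inr hπ.2)

/-! ### §3. Substituting a constant for one variable; interpolation (the printed proof) -/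

section Interp

variable {m : ℕ} (x₀ : Fin m × Fin m)

/-- **Skew complexity under the substitution `X_{x₀} ← c`** (other variables unchanged): an affine
substitution, so `L_skew(f(X_{x₀} ← c)) ≤ (L_skew(f) + m²)(2m² + 3)`
(`skewComplexity_aeval_affine_le`). [cite: BurgisserEtAl2011, §9.3 (closure under substitution)] -/
theorem skewComplexity_aeval_pointSubst_le (c : ℂ) (f : MvPolynomial (Fin m × Fin m) ℂ) :
    skewComplexity (aeval (fun v : Fin m × Fin m => if v = x₀ then C c else X v) f) ≤
      (skewComplexity f + m * m) * (2 * (m * m) + 3) := by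
  classical
  have hpsi : (SkewSubst.psi (fun v : Fin m × Fin m => if v = x₀ then c else 0)
      (fun v t : Fin m × Fin m => if v = x₀ then (0 : ℂ) else if t = v then 1 else 0)) =
      (fun v : Fin m × Fin m => if v = x₀ then C c else X v) := by
    funext v
    simp only [SkewSubst.psi]
    split_ifs with h
    · simp
    · rw [map_zero, zero_add]
      simp only [ite_smul, one_smul, zero_smul]
      rw [Finset.sum_ite_eq' Finset.univ v, if_pos (Finset.mem_univ _)]
  have h := skewComplexity_aeval_affine_le (fun v : Fin m × Fin m => if v = x₀ then c else 0)
    (fun v t : Fin m × Fin m => if v = x₀ then (0 : ℂ) else if t = v then 1 else 0) f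
  rw [hpsi] at h
  simpa only [Fintype.card_prod, Fintype.card_fin] using h

/-- **The interpolation step of the printed proof**: if `f = X_{x₀}^e · g` with `g = X_{x₀} P + Q`
and `X_{x₀}` does not appear in `P` or `Q` (they are fixed by the substitutions `X_{x₀} ← c`), then
"Setting `X_{1,1} ← 1` … we obtain `R₁ := P + Q` and setting `X_{1,1} ← 2` we obtain
`R₂ := 2^{n-m+1} P + 2^{n-m} Q`. We see that `P = -2^{-(n-m)}(2^{n-m} R₁ - R₂)` and
`Q = 2^{-(n-m)}(2^{n-m+1} R₁ - R₂)`", and `g = X_{x₀} P + Q` costs one more skew product and one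
sum: `L_skew(g) ≤ 4 (L_skew(f) + m²)(2m² + 3) + 10`. [cite: IkenmeyerPanova2017, §7 Claim 7.1 (proof; TeX L1511–1516)] -/
theorem skewComplexity_le_of_eq_X_pow_mul {e : ℕ} {g P Q : MvPolynomial (Fin m × Fin m) ℂ}
    (hg : g = X x₀ * P + Q)
    (hP : ∀ c : ℂ, aeval (fun v : Fin m × Fin m => if v = x₀ then C c else X v) P = P)
    (hQ : ∀ c : ℂ, aeval (fun v : Fin m × Fin m => if v = x₀ then C c else X v) Q = Q) :
    skewComplexity g ≤ 4 * ((skewComplexity (X x₀ ^ e * g) + m * m) * (2 * (m * m) + 3)) + 10 := by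
  classical
  set f := X x₀ ^ e * g with hf
  set B := (skewComplexity f + m * m) * (2 * (m * m) + 3) with hB
  -- the two substitutions
  set R : ℂ → MvPolynomial (Fin m × Fin m) ℂ :=
    fun c => aeval (fun v : Fin m × Fin m => if v = x₀ then C c else X v) f with hR
  have hRval : ∀ c : ℂ, R c = C c ^ e * (C c * P + Q) := by
    intro c
    simp only [hR, hf, hg, map_mul, map_pow, map_add, aeval_X, if_true, hP c, hQ c]
  have hRle : ∀ c : ℂ, skewComplexity (R c) ≤ B := fun c =>
    skewComplexity_aeval_pointSubst_le x₀ c f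
  -- P and Q as linear combinations of R 1 and R 2
  have h2e : (C ((2⁻¹ : ℂ) ^ e) : MvPolynomial (Fin m × Fin m) ℂ) * C (2 : ℂ) ^ e = 1 := by
    rw [← map_pow, ← map_mul, ← mul_pow, inv_mul_cancel₀ (two_ne_zero), one_pow, map_one]
  have hPeq : P = ∑ i : Fin 2, (![(-1 : ℂ), (2⁻¹ : ℂ) ^ e] i) • (![R 1, R 2] i) := by
    rw [Fin.sum_univ_two]
    simp only [Matrix.cons_val_zero, Matrix.cons_val_one]
    rw [hRval 1, hRval 2, MvPolynomial.smul_eq_C_mul, MvPolynomial.smul_eq_C_mul, map_one, one_pow,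
      one_mul, one_mul, ← mul_assoc, h2e, one_mul, map_neg, map_one,
      show (C (2 : ℂ) : MvPolynomial (Fin m × Fin m) ℂ) = 2 from map_ofNat C 2]
    ring
  have hQeq : Q = ∑ i : Fin 2, (![(2 : ℂ), -((2⁻¹ : ℂ) ^ e)] i) • (![R 1, R 2] i) := by
    rw [Fin.sum_univ_two]
    simp only [Matrix.cons_val_zero, Matrix.cons_val_one]
    rw [hRval 1, hRval 2, MvPolynomial.smul_eq_C_mul, MvPolynomial.smul_eq_C_mul, map_one, one_pow,
      one_mul, one_mul, map_neg, neg_mul, ← mul_assoc, h2e, one_mul,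
      show (C (2 : ℂ) : MvPolynomial (Fin m × Fin m) ℂ) = 2 from map_ofNat C 2]
    ring
  have hPle : skewComplexity P ≤ B + B + 3 := by
    have h := skewComplexity_sum_smul_le (Finset.univ : Finset (Fin 2))
      (![(-1 : ℂ), (2⁻¹ : ℂ) ^ e]) (![R 1, R 2])
    rw [← hPeq] at h
    simp only [Fin.sum_univ_two, Matrix.cons_val_zero, Matrix.cons_val_one, Finset.card_univ,
      Fintype.card_fin] at h
    have h1 := hRle 1
    have h2 := hRle 2
    omega
  have hQle : skewComplexity Q ≤ B + B + 3 := by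
    have h := skewComplexity_sum_smul_le (Finset.univ : Finset (Fin 2))
      (![(2 : ℂ), -((2⁻¹ : ℂ) ^ e)]) (![R 1, R 2])
    rw [← hQeq] at h
    simp only [Fin.sum_univ_two, Matrix.cons_val_zero, Matrix.cons_val_one, Finset.card_univ,
      Fintype.card_fin] at h
    have h1 := hRle 1
    have h2 := hRle 2
    omega
  -- g = P · X_{x₀} + Q
  have hPX := skewComplexity_mul_X_le P x₀
  have hg' : g = P * X x₀ + Q := by rw [hg, mul_comm]
  have hadd := skewComplexity_add_le (P * X x₀) Q
  rw [← hg'] at hadd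
  omega

end Interp

/-! ### §4. From skew circuits to determinantal representations -/

/-- A polynomial with a (well-formed, fan-in-two) skew circuit of size `s` is a projection of
`det_{3s+1}` (the tree's `HI16Skew.isProjection_detPoly_of_isSkew`, Malod–Portier 2008 Lemma 6),
hence has an affine determinantal representation of size `3 L_skew + 1`.
[cite: MalodPortier2008, Lemma 6] -/
theorem hasDetRepr_of_skewComplexity {σ : Type*} (g : MvPolynomial σ ℂ) :
    HasDetRepr g (3 * skewComplexity g + 1) := by
  obtain ⟨P, _, h2, hsk, hc, hsz⟩ := HI16Skew.skewComplexity_attained g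
  have hproj := HI16Skew.isProjection_detPoly_of_isSkew P h2 hsk
  rw [ArithCircuit.Computes] at hc
  rw [hc, hsz] at hproj
  exact IsDetProjection.hasDetRepr_holds hproj

/-- Determinantal representations pass from `rename j p` (injective `j`) back to `p`: `p` is a
projection of `rename j p` (send the variables in the image back, the others to `0`).
[cite: Burgisser2000, §2.5] -/
theorem hasDetRepr_of_rename {α β : Type*} [DecidableEq β] {j : α → β} (hj : Function.Injective j)
    {p : MvPolynomial α ℂ} {N : ℕ} (h : HasDetRepr (rename j p) N) : HasDetRepr p N := by
  classical
  refine HasDetRepr.of_isProjection_holds h ⟨fun v => if hv : ∃ w, j w = v then X hv.choose else C 0,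
    fun v => ?_, ?_⟩
  · by_cases hv : ∃ w, j w = v
    · refine Or.inl ⟨hv.choose, ?_⟩
      show (if hv : ∃ w, j w = v then X hv.choose else C 0) = X hv.choose
      rw [dif_pos hv]
    · refine Or.inr ⟨0, ?_⟩
      show (if hv : ∃ w, j w = v then X hv.choose else C 0) = C 0
      rw [dif_neg hv]
  · rw [aeval_rename]
    have hcomp : ((fun v => if hv : ∃ w, j w = v then X hv.choose else C 0) ∘ j) =
        (X : α → MvPolynomial α ℂ) := by
      funext w
      have hw : ∃ w', j w' = j w := ⟨w, rfl⟩
      simp only [Function.comp_apply, dif_pos hw]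
      congr 1
      exact hj hw.choose_spec
    rw [hcomp, aeval_X_left, AlgHom.id_apply]

/-- `per_0 = 1` has determinantal representations of every size (the empty permanent is `1`, the
empty determinant is `1`; then pad). [cite: Burgisser2000, §2.5 (determinantal representations)] -/
private theorem hasDetRepr_perPoly_fin_zero (N : ℕ) : HasDetRepr (perPoly (Fin 0) ℂ) N := by
  have h0 : HasDetRepr (perPoly (Fin 0) ℂ) 0 :=
    ⟨1, fun i => Fin.elim0 i, by rw [Matrix.det_isEmpty, perPoly, Matrix.permanent_isEmpty]⟩
  exact HasDetRepr.mono_holds h0 (Nat.zero_le N)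

/-! ### §5. The bound `N(m)` and the main lemma: `dc(per_n) ≤ N(m)` from `X_{1,1}^{m-n} per_n ∈ E_m det_m` -/

/-- The skew complexity of everything in the endomorphism orbit of `det_m` (on `m²` variables):
`L_skew(g) ≤ m²(m²+1) + (2m²+2) · 4 · (m+2)(4m³+7)²` (the tree's `L_ws(det_m)` bound, `L_skew ≤ 4 L_ws`,
and closure under linear substitution). [cite: BurgisserEtAl2011, §9.1 (i) and §9.3] -/
theorem skewComplexity_le_of_mem_endOrbit_detPoly {m : ℕ} {g : MvPolynomial (Fin m × Fin m) ℂ}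
    (hg : g ∈ endOrbit (Fin m × Fin m) ℂ (detPoly (Fin m) ℂ)) :
    skewComplexity g ≤ m * m * (m * m + 1) + (2 * (m * m) + 2) * (4 * ((m + 2) * (4 * m ^ 3 + 7) ^ 2)) := by
  have h1 := skewComplexity_le_of_mem_endOrbit hg
  have h2 := skewComplexity_le_four_mul_wsComplexity (detPoly (Fin m) ℂ)
  have h3 := HI16Skew.wsComplexity_detPoly_le ℂ m
  simp only [Fintype.card_prod, Fintype.card_fin] at h1
  calc skewComplexity g ≤ m * m * (m * m + 1) + (2 * (m * m) + 2) * skewComplexity (detPoly (Fin m) ℂ) := h1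
    _ ≤ m * m * (m * m + 1) + (2 * (m * m) + 2) * (4 * ((m + 2) * (4 * m ^ 3 + 7) ^ 2)) := by
      gcongr
      exact h2.trans (Nat.mul_le_mul_left 4 h3)

/-- **The determinantal-complexity form of Claim 7.1**: if `X_{1,1}^{m-n} per_n ∈ E_m det_m` (BIP's
padding, `bipPaddedPerPoly`), then `per_n` has an affine determinantal representation of size
`3 · (4 (B₁(m) + m²)(2m²+3) + 10) + 1`, `B₁(m)` the bound of
`skewComplexity_le_of_mem_endOrbit_detPoly` — polynomial in `m` (the printed `N = 4q(n) + 8` with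
`q` = skew complexity of `det`, up to the tree's gate-count conventions).
[cite: IkenmeyerPanova2017, §7 Claim 7.1 (proof; TeX L1509–1517)] -/
theorem hasDetRepr_perPoly_of_bipPadded_mem_endOrbit {n m : ℕ} [NeZero m] (hnm : n ≤ m)
    (h : Literature.Computability.Complexity.bipPaddedPerPoly ℂ n m ∈
      endOrbit (Fin m × Fin m) ℂ (detPoly (Fin m) ℂ)) :
    HasDetRepr (perPoly (Fin n) ℂ)
      (3 * (4 * ((m * m * (m * m + 1) + (2 * (m * m) + 2) * (4 * ((m + 2) * (4 * m ^ 3 + 7) ^ 2)) +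
        m * m) * (2 * (m * m) + 3)) + 10) + 1) := by
  classical
  rcases Nat.eq_zero_or_pos n with rfl | hn
  · exact hasDetRepr_perPoly_fin_zero _
  -- the top-left block embedding and its corner
  set ι : Literature.Computability.Complexity.TopBlockIdx n m → Fin m := fun i => (i : Fin m) with hι
  have hιinj : Function.Injective ι := fun a b hab => Subtype.ext hab
  set a : Literature.Computability.Complexity.TopBlockIdx n m := ⟨0, by simpa using hn⟩ with ha
  have hx₀ : (ι a, ι a) = ((0 : Fin m), (0 : Fin m)) := rfl
  -- per' = X₀₀ P + Q
  obtain ⟨P, Q, hsplit, hfix⟩ :=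
    exists_perPoly_eq_X_mul_add (k := ℂ) ι hιinj a
  rw [hx₀] at hsplit hfix
  set g := rename (Prod.map ι ι) (perPoly (Literature.Computability.Complexity.TopBlockIdx n m) ℂ)
    with hgdef
  have hf : Literature.Computability.Complexity.bipPaddedPerPoly ℂ n m = X (0, 0) ^ (m - n) * g := rfl
  have hfix' : ∀ c : ℂ, aeval (fun v : Fin m × Fin m => if v = ((0 : Fin m), (0 : Fin m)) then C c else X v) P = P ∧
      aeval (fun v : Fin m × Fin m => if v = ((0 : Fin m), (0 : Fin m)) then C c else X v) Q = Q :=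
    fun c => hfix _ fun v hv => if_neg hv
  have hsc := skewComplexity_le_of_eq_X_pow_mul ((0 : Fin m), (0 : Fin m)) (e := m - n) hsplit
    (fun c => (hfix' c).1) (fun c => (hfix' c).2)
  rw [← hf] at hsc
  have hB := skewComplexity_le_of_mem_endOrbit_detPoly h
  -- det representation of g, then of per_n
  have hdet := hasDetRepr_of_skewComplexity g
  have hdet' : HasDetRepr g
      (3 * (4 * ((m * m * (m * m + 1) + (2 * (m * m) + 2) * (4 * ((m + 2) * (4 * m ^ 3 + 7) ^ 2)) +
        m * m) * (2 * (m * m) + 3)) + 10) + 1) := by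
    refine HasDetRepr.mono_holds hdet ?_
    have : skewComplexity g ≤ 4 * ((m * m * (m * m + 1) + (2 * (m * m) + 2) *
        (4 * ((m + 2) * (4 * m ^ 3 + 7) ^ 2)) + m * m) * (2 * (m * m) + 3)) + 10 :=
      hsc.trans (by gcongr)
    omega
  -- transport `g = rename (ι×ι ∘ e×e) per_(Fin n)` back to `per_n`
  have hcard : Fintype.card (Literature.Computability.Complexity.TopBlockIdx n m) = n :=
    Fintype.card_fin_lt_of_le hnm
  set e : Fin n ≃ Literature.Computability.Complexity.TopBlockIdx n m :=
    (Fintype.equivFinOfCardEq hcard).symm with he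
  have hg' : g = rename (Prod.map (ι ∘ e) (ι ∘ e)) (perPoly (Fin n) ℂ) := by
    rw [hgdef, ← rename_perPoly_equiv e, rename_rename]
    rfl
  rw [hg'] at hdet'
  exact hasDetRepr_of_rename (j := Prod.map (ι ∘ e) (ι ∘ e))
    ((hιinj.comp e.injective).prodMap (hιinj.comp e.injective)) hdet'

/-! ### §6. Claim 7.1 -/

/-- **Ikenmeyer–Panova 2017, Claim 7.1 (Appendix §7), DISCHARGED**: "There exists a function
`N = N(n)` that is polynomially bounded in `n` such that if `X_{1,1}^{n-m} per_m ∈ E_n det_n`, then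
`X_{N,N}^{N-m} per_m ∈ E_N det_N`" — with the explicit polynomial
`N(m) = 3 · (4 (B₁(m) + m²)(2m²+3) + 10) + 1 + m`. Proof as printed: a skew circuit for `det`
(tree: `L_ws(det_m) ≤ (m+2)(4m³+7)²`, `L_skew ≤ 4 L_ws`) composed with the linear substitution,
interpolation at `X_{1,1} ← 1, 2`, one skew product `X_{1,1} · P`, the universality of the
determinant for skew circuits, and homogenisation with the fresh padding variable
(`X_pow_mul_rename_mem_endOrbit_detPoly`). [cite: IkenmeyerPanova2017, §7 Claim 7.1 (TeX L1505–1517; held: Claim 35, chunk p0017)] -/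
theorem ikenmeyerPanova2017_claim_7_1_holds : ikenmeyerPanova2017_claim_7_1 := by
  classical
  refine ⟨fun m => 3 * (4 * ((m * m * (m * m + 1) + (2 * (m * m) + 2) *
      (4 * ((m + 2) * (4 * m ^ 3 + 7) ^ 2)) + m * m) * (2 * (m * m) + 3)) + 10) + 1 + m, ?_, ?_, ?_⟩
  · refine (isPBounded_iff_exists_polynomial_holds _).2
      ⟨3 * (4 * ((Polynomial.X * Polynomial.X * (Polynomial.X * Polynomial.X + 1) +
        (2 * (Polynomial.X * Polynomial.X) + 2) * (4 * ((Polynomial.X + 2) * (4 * Polynomial.X ^ 3 + 7) ^ 2)) +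
        Polynomial.X * Polynomial.X) * (2 * (Polynomial.X * Polynomial.X) + 3)) + 10) + 1 + Polynomial.X,
        fun m => le_of_eq ?_⟩
    simp [Polynomial.eval_add, Polynomial.eval_mul, Polynomial.eval_pow, Polynomial.eval_X]
  · intro m
    exact Nat.le_add_left m _
  · intro n m _ _ hnm hmem
    have hrep := hasDetRepr_perPoly_of_bipPadded_mem_endOrbit hnm hmem
    set N := 3 * (4 * ((m * m * (m * m + 1) + (2 * (m * m) + 2) *
      (4 * ((m + 2) * (4 * m ^ 3 + 7) ^ 2)) + m * m) * (2 * (m * m) + 3)) + 10) + 1 + m with hN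
    have hnN : n ≤ N := hnm.trans (Nat.le_add_left m _)
    have hrepN : HasDetRepr (perPoly (Fin n) ℂ) N := HasDetRepr.mono_holds hrep (Nat.le_add_right _ _)
    -- homogenise with the fresh corner variable (the pattern of
    -- `paddedPerPoly_mem_orbitClosure_detPoly_of_hasDetRepr_holds`)
    set e : Fin n ≃ BlockIdx n N := (Fintype.equivFinOfCardEq (card_blockIdx hnN)).symm with he
    have hper : perPoly (BlockIdx n N) ℂ = rename (Prod.map e e) (perPoly (Fin n) ℂ) :=
      (rename_perPoly_equiv e).symm
    show paddedPerPoly ℂ n N ∈ _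
    rw [paddedPerPoly, hper, rename_rename]
    have hhom : (perPoly (Fin n) ℂ).IsHomogeneous n := by
      simpa using (perPoly_isHomogeneous (n := Fin n) (k := ℂ))
    exact X_pow_mul_rename_mem_endOrbit_detPoly hhom hnN hrepN _ _

end IP17Padding

/-- Re-export at the level of the statement file's namespace. [cite: IkenmeyerPanova2017, §7 Claim 7.1] -/
theorem ikenmeyerPanova2017_claim_7_1_holds : ikenmeyerPanova2017_claim_7_1 :=
  IP17Padding.ikenmeyerPanova2017_claim_7_1_holds

end Literature.Computability.AlgebraicComplexity
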